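import Mathlib
import Summits.Schanuel.Schanuel.Statement
import Literature.NumberTheory.Transcendental.RoyCriterion
import Summits.Schanuel.Schanuel.Theorems.SoloBlindRoyWindow
import HarnessLib

/-!
# Roy's window lies inside the profile no-go region (solo-Schanuel-blind, session 3)

Write `δ := max{t₀, s₁+t₁}` for the degree exponent and `σ` (any `s₀ ≤ σ < u`) for the log-height
exponent of the *orbit family* `{(D^k P_N)∘[m] : k ≤ N^{s₀}, ‖m‖ ≤ N^{s₁}}` that the hypothesis of
Roy's Conjecture 2 produces at a point `θ = (y, α) ∈ ℂ^{2l}` (degrees `≤ N^δ`, log-heights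
`≍ N^{s₀} log N ≤ N^σ`, sizes `≤ exp(-N^u)` up to constants; Roy 2001 §1, Waldschmidt LNM 2313 §8).

Proposition NG of `run/shared/lean/ideation/Schanuel/solo-blind/paper/nogo.md` (proved there, with an
exact-arithmetic check in `work/nogo_check.py`) says: for `l ≥ 3`, **every** criterion that concludes
`trdeg ℚ(θ) ≥ l` from the PROFILE of a family alone — cardinality, degrees `≤ N^δ`, log-heights
`≤ N^σ`, sizes `≤ exp(-N^u)` at `θ` for all large `N`, and absence of common zeros in `ℂ^{2l}` — is
false as soon as
`δ < u`, `σ < u` and `max{u,σ,δ}·(u - δ) < σ²`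
(witness: `θ = (x₁, x₂, 1, …, 1)` with two Liouville numbers of interleaved scales, trdeg `≤ 2`).

This file proves that these three inequalities hold at EVERY admissible parameter quintuple of
Roy's window and every `σ ∈ [s₀, u)`; in fact `u·(u - δ) < 1 - t₁² < 1 < s₀² ≤ σ²`
(`royAdmissible_profile_gap`, `royAdmissible_profile_nogo`). Consequence recorded in the wall
statement (§4, R-A3): since the ranks `l ≥ 3` decide Schanuel (`schanuel_iff_eventually`), no
profile-reading criterion (Philippon 1986, Jabbouri 1992, Laurent–Roy 2001, Philippon's
"approximations algébriques" criteria) can complete Roy's programme at any admissible parameter;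
the algebraic relations inside the orbit family must be used.

[cite: Roy2001, condition (1); Waldschmidt 2022, LNM 2313, Conjecture 8.1; Nesterenko–Philippon (eds.),
LNM 1752 (2001), Ch. 8 (criteria for algebraic independence) and Ch. 15 §3 (Amoroso), Lemma 3.2]
-/

namespace Summit.Schanuel.Schanuel.Theorems

open Literature.NumberTheory.Transcendental

variable {s₀ s₁ t₀ t₁ u : ℝ}

/-- The degree exponent `δ = max{t₀, s₁+t₁}` of the orbit family lies strictly below the smallness
exponent `u`, and so does the height exponent `s₀`. -/
theorem royAdmissible_profile_exponents (h : RoyAdmissible s₀ s₁ t₀ t₁ u) :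
    max t₀ (s₁ + t₁) < u ∧ s₀ < u ∧ 0 < u - max t₀ (s₁ + t₁) := by
  obtain ⟨h0, h1, h2, h3, h4, g1, g2, g3, g4, g5, g6, k1, k2, k3⟩ := royAdmissible_unpack h
  have hδ : max t₀ (s₁ + t₁) < u := max_lt (by linarith) k2
  exact ⟨hδ, k1, by linarith⟩

/-- Two range facts behind the gap inequality: `t₀ < 1 + t₁` and `3 t₁ - 1 < t₀`
(from `t₀ < s₀ < u < (1+t₀+t₁)/2` and `2t₁ < s₀ < u < (1+t₀+t₁)/2`). -/
theorem royAdmissible_t₀_window (h : RoyAdmissible s₀ s₁ t₀ t₁ u) :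
    t₀ < 1 + t₁ ∧ 3 * t₁ - 1 < t₀ := by
  obtain ⟨h0, h1, h2, h3, h4, g1, g2, g3, g4, g5, g6, k1, k2, k3⟩ := royAdmissible_unpack h
  constructor <;> linarith

/-- The gap inequality: `u · (u - δ) < 1 - t₁² < 1`, where `δ = max{t₀, s₁+t₁}`. -/
theorem royAdmissible_profile_gap (h : RoyAdmissible s₀ s₁ t₀ t₁ u) :
    u * (u - max t₀ (s₁ + t₁)) < 1 - t₁ ^ 2 ∧ 1 - t₁ ^ 2 < 1 := by
  obtain ⟨h0, h1, h2, h3, h4, g1, g2, g3, g4, g5, g6, k1, k2, k3⟩ := royAdmissible_unpack h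
  have e1 : u - t₀ < 1 - t₁ := by linarith
  have e2 : u < 1 + t₁ := by linarith
  have e3 : 0 < 1 - t₁ := by linarith
  have m1 : u * (u - max t₀ (s₁ + t₁)) ≤ u * (u - t₀) :=
    mul_le_mul_of_nonneg_left (sub_le_sub_left (le_max_left _ _) u) h4.le
  have m2 : u * (u - t₀) < u * (1 - t₁) := mul_lt_mul_of_pos_left e1 h4
  have m3 : u * (1 - t₁) < (1 + t₁) * (1 - t₁) := mul_lt_mul_of_pos_right e2 e3
  constructor
  · nlinarith
  · nlinarith

/-- **Placement of the window in the profile no-go region.** For every admissible quintuple and every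
height exponent `σ` with `s₀ ≤ σ < u`: `δ < u`, `σ < u` and `max{u,σ,δ}·(u - δ) < σ²`
(`δ = max{t₀, s₁+t₁}`), the hypotheses of Proposition NG of `paper/nogo.md`. -/
theorem royAdmissible_profile_nogo (h : RoyAdmissible s₀ s₁ t₀ t₁ u) {σ : ℝ}
    (hσ : s₀ ≤ σ) (hσu : σ < u) :
    max t₀ (s₁ + t₁) < u ∧ σ < u ∧
      max u (max σ (max t₀ (s₁ + t₁))) * (u - max t₀ (s₁ + t₁)) < σ ^ 2 := by
  obtain ⟨hδ, hs, hpos⟩ := royAdmissible_profile_exponents h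
  obtain ⟨hgap, _⟩ := royAdmissible_profile_gap h
  obtain ⟨h0, h1, h2, h3, h4, g1, -⟩ := royAdmissible_unpack h
  have hmax : max u (max σ (max t₀ (s₁ + t₁))) = u :=
    max_eq_left (max_le hσu.le hδ.le)
  refine ⟨hδ, hσu, ?_⟩
  rw [hmax]
  have hσ1 : 1 ≤ σ := by linarith
  have hsq : 1 ≤ σ ^ 2 := by nlinarith
  have ht : 0 ≤ t₁ ^ 2 := sq_nonneg _
  linarith

/-- Sanity instance at the in-tree admissible point `(s₀,s₁,t₀,t₁,u) = (1.3, 0.7, 1.2, 0.5, 1.32)`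
with `σ = s₀`: `δ = 1.2 < 1.32`, and `1.32 · 0.12 = 0.1584 < 1.69 = 1.3²`. -/
example : max (1.32 : ℝ) (max 1.3 (max 1.2 (0.7 + 0.5))) * (1.32 - max 1.2 (0.7 + 0.5)) < 1.3 ^ 2 := by
  norm_num

#harness_tags royAdmissible_profile_nogo

end Summit.Schanuel.Schanuel.Theorems
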